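import Summits.BirchSwinnertonDyer.BirchSwinnertonDyer.Theorems.AdditiveKolyvaginRoadAdditiveKolyvaginKernel
import Summits.BirchSwinnertonDyer.BirchSwinnertonDyer.Theorems.AdditiveBranchIMCGordTwoRankOneHeegnerKolyvaginItem
import Summits.BirchSwinnertonDyer.BirchSwinnertonDyer.Theorems.AdditiveBranchIMCGordTwoRankOneHeegnerKolyvaginAdjustedCertificate
import Literature.NumberTheory.EllipticCurves.ZywinaCMImageProofs
import HarnessLib

/-!
# Route `AdditiveBranchIMC` (rung K1), crux `GordTwoRankOne` (item 19358): the Heegner–Kolyvagin road, Part 17 —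
# the HORIZONTAL (Kolyvagin-index) road on the ♯ rows from the sibling route `AdditiveKolyvaginRoad`'s crux BY NAME
# (cell `bsd-addord`, lane `bsd-addord-k1-c3x`, gen 3; REPAIRED gen 4 after the sibling's route rev 20)

HONEST FRAMING. THEOREMS ONLY (no definition, no named fact, no `sorry`); nothing booked; 19358 and 20498 stay
OPEN; BSD is not proved by any of this. The sibling route (cell `pub/bsd-wall`) is consumed BY NAME; none of its
files is touched. REPAIR (gen 4): rev 20 inserted `NumberField.discr K < -4 →` into `KolyvaginPrimitiveAdditive[AbelianType]`
(items 21400/21398, formerly 20132/20418); the new core `…_of_kolyvaginClasses_lt` asks the classes only at frames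
with `d_K < −4` (the kernel's Hoffstein–Luo frame has it); the gen-3 core is its corollary; all other statements are
unchanged. §23 LOWER half on the ♯ rows (`p ≥ 5`) from the sibling crux + PUB; §24 crux BY NAME; §25 item 20498 on
the ♯ rows. Details + references: HOME/k1-c3x/ROAD-KOLYVAGIN-19358-g3.md, -g4.md ([WZhang2014], [McCallumLMS1991],
[JetchevSkinnerWan2017], [Kato2004Asterisque], [Darmon2004], [HoffsteinLuo1997], [LiLiuTian2024], [Miller2011LMS]).
-/
set_option autoImplicit false
set_option linter.dupNamespace false
noncomputable section
open scoped Classical NumberField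
open WeierstrassCurve NumberField IsDedekindDomain Literature.NumberTheory.EllipticCurves
  Literature.NumberTheory.EllipticCurves.ModularForms Literature.NumberTheory.EllipticCurves.Rank1Residual
  Literature.NumberTheory.EllipticCurves.Rank1Residual.Typed Literature.NumberTheory.Automorphic
  Summit.BirchSwinnertonDyer.Rank1Residual Summit.BirchSwinnertonDyer.Rank1Residual.Additive
  Summit.BirchSwinnertonDyer.Rank1Residual.X11b Summit.BirchSwinnertonDyer.Rank1Residual.GaloisImage
  Summit.BirchSwinnertonDyer.BirchSwinnertonDyer.Theses.AdditiveKolyvaginRoad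
  Summit.BirchSwinnertonDyer.BirchSwinnertonDyer.Theorems.AdditiveKolyvaginKernel

namespace Summit.BirchSwinnertonDyer.BirchSwinnertonDyer.Theorems.AdditiveBranchIMCGordTwoRankOne.HeegnerKolyvagin
/-! ### §23 The crux's LOWER half on the ♯ rows from Kolyvagin's conjecture mod `p` (sibling crux) + PUB -/

/-- **THE HORIZONTAL KERNEL FOR THE LOWER HALF (one pair), every ODD `p` — classes asked only at odd frames
with `d_K < −4`** (the sibling's rev-20 shape of items 21400/21398); otherwise verbatim the gen-3 core below, which
is now its corollary. [cite: WZhang2014, Thm. 1.1 and Thm. 10.2] [cite: McCallumLMS1991, §5 Cor. 5.6 (p. 310)]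
[cite: Kato2004Asterisque, Thm. 14.5 (3) (p. 236)] [cite: JetchevSkinnerWan2017, §7.4.1 (pp. 29–31)] [cite: Darmon2004, Thm. 3.6] -/
theorem missingLowerBoundAt_rankOne_additive_potGood_of_kolyvaginClasses_lt
    (hPub : PublishedInputsAdditiveKoly)
    (hKatoT : Kato2004.rankZero_padicValNat_sha_add_padicValNat_tamagawa_le_of_additive_potGood_of_imageContainsSL2)
    (W : WeierstrassCurve ℚ) [W.IsElliptic] [W.IsGloballyMinimal] [NeZero (W.conductorNorm ℤ)]
    (p : ℕ) [Fact p.Prime] (hCM : ¬ W.HasCM) (hp2 : p ≠ 2) (hadd : Addv W p)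
    (hj : 0 ≤ padicValRat p W.j) (hr : W.analyticRank = 1)
    (hsurj : ∀ m : ℕ, W.HasSurjectiveModNGaloisRep (p ^ m : ℕ))
    (hD : ∃ Dt : ModularParametrizationData W (W.conductorNorm ℤ), ¬ (p : ℤ) ∣ Dt.c)
    (hKolyW : ∀ (K : Type) [Field K] [NumberField K]
      (Dt : ModularParametrizationData W (W.conductorNorm ℤ)) (β : ℤ) (ι : K →+* ℂ),
      IsImaginaryQuadratic K → Odd (NumberField.discr K) → NumberField.discr K < -4 →
      SatisfiesHeegnerHypothesis (W.conductorNorm ℤ) K →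
      (W.quadraticTwist (NumberField.discr K : ℚ)).entireLFunction 1 ≠ 0 →
      (4 * (W.conductorNorm ℤ : ℤ)) ∣ β ^ 2 - NumberField.discr K → ¬ (p : ℤ) ∣ Dt.c →
      ∃ (n : ℕ) (d : KolyvaginHeegnerData Dt β ι n),
        KolyvaginDescent.KolSupp (Zhang2014.IsKolyvaginPrime (W.conductorNorm ℤ) W K p) n ∧
        d.kolyvaginClass (Fact.out : p.Prime) 1 ≠ 0) :
    Typed.MissingLowerBoundAt W p := by
  obtain ⟨hGZ, hKo, hB, hGZK, hmod, hnf, hHL, hrec, hMc, h36⟩ := hPub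
  have hp : p.Prime := Fact.out
  have hsurjp : W.HasSurjectiveModNGaloisRep p := by simpa using hsurj 1
  have hirr : Irr W p := hasIrreducibleModPGaloisRep_of_hasSurjectiveModNGaloisRep W p hsurjp
  -- kernel steps 1–3: tower surjectivity, the odd frame with `d_K < -4`, Darmon's datum, Kolyvagin
  obtain ⟨K, _, _, Dt, H, ι, P, Wd, _, _, Cd, hK, hodd, hlt, hpd, hHN, hP, hc, hμ, hLt, hWd⟩ :=
    exists_oddHeegnerFrame_lt_of_exists_not_dvd hnf hHL W p hr hp2 hD
  have h3 : NumberField.discr K ≠ -3 := by omega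
  have h4 : NumberField.discr K ≠ -4 := by omega
  obtain ⟨d₁⟩ := kolyvaginRoadThree_hKD_of_darmon36 h36 W K Dt H.β ι hK hHN H.dvd_sq_sub
  have hPd : d₁.toGeomPoints d₁.derivedPoint = toGeomPoints (W.baseChange K) P :=
    KolyvaginBottom.toGeomPoints_derivedPoint_one_eq (hrec _ W K) hK hHN hP d₁ rfl
  have hPinf : ¬ IsOfFinAddOrder P :=
    not_isOfFinAddOrder_of_heegner_of_analyticRank_eq_one W (W.conductorNorm ℤ) K Dt H ι P (hGZ _ W K)
      hmod hr hK hHN hLt hP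
  obtain ⟨hrank, hSha⟩ := hKo (W.conductorNorm ℤ) W K hK hHN ⟨Dt, H, ι, hP⟩ hPinf
  haveI : Finite (W.baseChange K).sha := hSha
  have hbot := torsionBy_eq_bot_of_isImaginaryQuadratic_of_hasIrreducibleModPGaloisRep W K hK hp hirr
  have hiv : ∀ x : (W.baseChange K).toAffine.Point, p • x = 0 → x = 0 := fun x hx ↦ by
    have hmem : x ∈ AddSubgroup.torsionBy (W.baseChange K).toAffine.Point ((p : ℕ) : ℤ) := by
      rw [mem_torsionBy_iff, natCast_zsmul]
      exact hx
    rw [hbot] at hmem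
    exact hmem
  haveI : Module.Finite ℤ (W.baseChange K).toAffine.Point := (W.baseChange K).module_finite_point_holds
  obtain ⟨M₀, x₀, hx₀, hmax⟩ := exists_pow_smul_eq_and_forall_ne hPinf (p := p) hp.two_le
  have hdiv : ∃ Q : (W.baseChange K).toAffine.Point, ((p ^ M₀ : ℕ) : ℤ) • Q = P :=
    ⟨x₀, by rw [natCast_zsmul]; exact hx₀⟩
  have hndiv : ¬ ∃ Q : (W.baseChange K).toAffine.Point, ((p ^ (M₀ + 1) : ℕ) : ℤ) • Q = P := by
    rintro ⟨Q, hQ⟩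
    exact hmax Q (by rw [← natCast_zsmul]; exact hQ)
  -- step 4: Kolyvagin's conjecture mod `p` at this frame; McCallum ⟹ the ADJUSTED bound (Part 17a)
  obtain ⟨n, d, hn, hne⟩ := hKolyW K Dt H.β ι hK hodd hlt hHN hLt H.dvd_sq_sub hc
  have hL' : (2 * padicValNat p (AddSubgroup.zmultiples P).index : ℤ) ≤
      padicValNat p (W.baseChange K).shaOrder + padicValNat p W.tamagawaProduct +
        padicValNat p Wd.tamagawaProduct + 2 * padicValRat p (Dt.c : ℚ) :=
    adjustedIndexBound_of_kolyvaginClass_ne_zero_of_mccallum hMc W hCM K hK h3 h4 hHN p hp2 hsurj Dt H.β ι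
      d₁ P hPd hPinf hrank hiv hdiv hndiv d hn hne Cd hWd
  exact missingLowerBoundAt_rankOne_additive_of_adjustedIndexBound W p K Dt H ι P (hGZ _ W K) (hKo _ W K)
    hKatoT hGZK hmod hr hp2 hadd hj hsurj hK hHN hP hμ hLt Wd Cd hWd (fun _ ↦ hL')

/-- **THE HORIZONTAL KERNEL FOR THE LOWER HALF (one pair), every ODD `p`.** `W/ℚ` globally minimal non-CM,
`p` odd ADDITIVE and potentially good (`0 ≤ ord_p j`), `r_an = 1`, `ρ̄_{E,p^m}` onto for all `m` (at `p ≥ 5`: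
`ρ̄_{E,p}` onto, Serre; at `p = 3` the tower-surjective rows); PUBLISHED inputs: the sibling
route's conjunction `PublishedInputsAdditiveKoly` (`hPub`: Gross–Zagier, Kolyvagin, Kolyvagin's bound,
GZK, modularity, newforms, Hoffstein–Luo, Shimura reciprocity at conductor 1, McCallum Cor. 5.6, Darmon
3.6) and Kato's Thm 14.5 (3) at an additive potentially good rank-zero pair with image ⊇ SL₂ (`hKatoT`); a
datum with `p ∤ c` (`hD`); KOLYVAGIN'S CONJECTURE MOD `p` AT THE FRAMES OF THIS CURVE (`hKolyW`).
CONCLUSION: `Typed.MissingLowerBoundAt W p` (kernel steps 1–4 verbatim, then Part 17a and Part 8's pointwise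
door; NO rank-zero residual, NO `p ∤ ∏c`, NO ♠). [cite: WZhang2014, Thm. 1.1 and Thm. 10.2]
[cite: McCallumLMS1991, §5 Cor. 5.6 (p. 310)] [cite: Kato2004Asterisque, Thm. 14.5 (3) (p. 236)]
[cite: JetchevSkinnerWan2017, §7.4.1 (pp. 29–31)] [cite: Darmon2004, Thm. 3.6] -/
theorem missingLowerBoundAt_rankOne_additive_potGood_of_kolyvaginClasses
    (hPub : PublishedInputsAdditiveKoly)
    (hKatoT : Kato2004.rankZero_padicValNat_sha_add_padicValNat_tamagawa_le_of_additive_potGood_of_imageContainsSL2)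
    (W : WeierstrassCurve ℚ) [W.IsElliptic] [W.IsGloballyMinimal] [NeZero (W.conductorNorm ℤ)]
    (p : ℕ) [Fact p.Prime] (hCM : ¬ W.HasCM) (hp2 : p ≠ 2) (hadd : Addv W p)
    (hj : 0 ≤ padicValRat p W.j) (hr : W.analyticRank = 1)
    (hsurj : ∀ m : ℕ, W.HasSurjectiveModNGaloisRep (p ^ m : ℕ))
    (hD : ∃ Dt : ModularParametrizationData W (W.conductorNorm ℤ), ¬ (p : ℤ) ∣ Dt.c)
    (hKolyW : ∀ (K : Type) [Field K] [NumberField K]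
      (Dt : ModularParametrizationData W (W.conductorNorm ℤ)) (β : ℤ) (ι : K →+* ℂ),
      IsImaginaryQuadratic K → Odd (NumberField.discr K) →
      SatisfiesHeegnerHypothesis (W.conductorNorm ℤ) K →
      (W.quadraticTwist (NumberField.discr K : ℚ)).entireLFunction 1 ≠ 0 →
      (4 * (W.conductorNorm ℤ : ℤ)) ∣ β ^ 2 - NumberField.discr K → ¬ (p : ℤ) ∣ Dt.c →
      ∃ (n : ℕ) (d : KolyvaginHeegnerData Dt β ι n),
        KolyvaginDescent.KolSupp (Zhang2014.IsKolyvaginPrime (W.conductorNorm ℤ) W K p) n ∧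
        d.kolyvaginClass (Fact.out : p.Prime) 1 ≠ 0) :
    Typed.MissingLowerBoundAt W p :=
  missingLowerBoundAt_rankOne_additive_potGood_of_kolyvaginClasses_lt hPub hKatoT W p hCM hp2 hadd hj hr hsurj hD
    (fun K _ _ Dt β ι hK hodd _ hHN hLt hβ hc ↦ hKolyW K Dt β ι hK hodd hHN hLt hβ hc)

/-- **The LOWER half on EVERY ♯ rank-one additive potentially good pair at `p ≥ 5` from the sibling
route's crux `KolyvaginPrimitiveAdditive` (Kolyvagin's conjecture mod `p` at an additive prime, ALL local
types) + its Manin-good frames + PUB (incl. Kato 14.5 (3) at the twist).** At the pair: `5 ≤ p`, `Addv`,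
`0 ≤ ord_p j` ((G-ord) of every defect, and (T′)), `r_an = 1`, `ρ̄_{E,p}` onto, ♠(1), ♠(2), `p ∤ ∏c(E)`
(the last three only FEED the crux; non-CM is automatic, Zywina 2015 Prop. 1.14). The sibling's
`RankZeroAdditive` is NOT needed for the LOWER half. [cite: WZhang2014, Thm. 1.1 and Thm. 10.2]
[cite: McCallumLMS1991, §5 Cor. 5.6 (p. 310)] [cite: Kato2004Asterisque, Thm. 14.5 (3) (p. 236)]
[cite: Zywina2015, Prop. 1.14] [cite: Miller2011LMS, Def. 1.1] -/
theorem missingLowerBoundAt_rankOne_additive_potGood_sharp_of_kolyvaginPrimitiveAdditive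
    (hPub : PublishedInputsAdditiveKoly) (hM : ManinGoodOddFrameAdditive)
    (hKoly : KolyvaginPrimitiveAdditive)
    (hKatoT : Kato2004.rankZero_padicValNat_sha_add_padicValNat_tamagawa_le_of_additive_potGood_of_imageContainsSL2) :
    ∀ (W : WeierstrassCurve ℚ) [W.IsElliptic] [W.IsGloballyMinimal] (p : ℕ) [Fact p.Prime],
      5 ≤ p → Addv W p → 0 ≤ padicValRat p W.j → W.analyticRank = 1 → W.HasSurjectiveModNGaloisRep p →
      (∀ (ℓ : ℕ) [Fact ℓ.Prime], W.HasMultiplicativeReductionAtPrime ℓ →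
        ¬ p ∣ padicValInt ℓ W.minimalDiscriminantInt) →
      (∃ (ℓ₁ ℓ₂ : ℕ) (_ : Fact ℓ₁.Prime) (_ : Fact ℓ₂.Prime), ℓ₁ ≠ ℓ₂ ∧
        W.HasMultiplicativeReductionAtPrime ℓ₁ ∧ W.HasMultiplicativeReductionAtPrime ℓ₂) →
      ¬ p ∣ W.tamagawaProduct → Typed.MissingLowerBoundAt W p := by
  intro W _ _ p _ hp5 hadd hj hr hsurjp hsp htwo htam
  haveI : NeZero (W.conductorNorm ℤ) := ⟨(W.conductorNorm_pos_holds).ne'⟩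
  have hp : p.Prime := Fact.out
  have hp2 : p ≠ 2 := by omega
  have hCM : ¬ W.HasCM := fun hcm ↦ not_hasSurjectiveModNGaloisRep_of_hasCM W hcm hp hp2 hsurjp
  have hirr : Irr W p := hasIrreducibleModPGaloisRep_of_hasSurjectiveModNGaloisRep W p hsurjp
  obtain ⟨K₀, _, _, Dt₀, -, -, -, -, -, -, -, -, -, -, -, -, hc₀, -, -, -⟩ := hM hPub W p hp5 hadd hirr hr
  exact missingLowerBoundAt_rankOne_additive_potGood_of_kolyvaginClasses_lt hPub hKatoT W p hCM hp2 hadd hj hr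
    (serre_hasSurjectiveModNGaloisRep_pow_holds W p hp5 hsurjp) ⟨Dt₀, hc₀⟩
    (fun K _ _ Dt β ι hK hodd hlt hHN hLt hβ hc ↦
      hKoly W p K Dt β ι hp5 hadd hsurjp hsp htwo htam hr hK hodd hlt hHN hLt hβ hc)

/-- **The LOWER half on every ♯ rank-one (G-ord)-locus pair at `p ≥ 5` from the ABELIAN-TYPE child ALONE**
(`KolyvaginPrimitiveAdditiveAbelianType`, item 20418) + Manin-good frames + PUB (incl. Kato at the twist);
`SubGord W p` = the census cell (G-ord), every defect `e ∣ p − 1`. [cite: WZhang2014, Thm. 1.1 and Thm. 10.2]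
[cite: McCallumLMS1991, §5 Cor. 5.6 (p. 310)] [cite: Kato2004Asterisque, Thm. 14.5 (3) (p. 236)] -/
theorem missingLowerBoundAt_rankOne_subGord_sharp_of_kolyvaginPrimitiveAdditiveAbelianType
    (hPub : PublishedInputsAdditiveKoly) (hM : ManinGoodOddFrameAdditive)
    (hKA : KolyvaginPrimitiveAdditiveAbelianType)
    (hKatoT : Kato2004.rankZero_padicValNat_sha_add_padicValNat_tamagawa_le_of_additive_potGood_of_imageContainsSL2) :
    ∀ (W : WeierstrassCurve ℚ) [W.IsElliptic] [W.IsGloballyMinimal] (p : ℕ) [Fact p.Prime],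
      5 ≤ p → Addv W p → SubGord W p → W.analyticRank = 1 → W.HasSurjectiveModNGaloisRep p →
      (∀ (ℓ : ℕ) [Fact ℓ.Prime], W.HasMultiplicativeReductionAtPrime ℓ →
        ¬ p ∣ padicValInt ℓ W.minimalDiscriminantInt) →
      (∃ (ℓ₁ ℓ₂ : ℕ) (_ : Fact ℓ₁.Prime) (_ : Fact ℓ₂.Prime), ℓ₁ ≠ ℓ₂ ∧
        W.HasMultiplicativeReductionAtPrime ℓ₁ ∧ W.HasMultiplicativeReductionAtPrime ℓ₂) →
      ¬ p ∣ W.tamagawaProduct → Typed.MissingLowerBoundAt W p := by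
  intro W _ _ p _ hp5 hadd hG hr hsurjp hsp htwo htam
  haveI : NeZero (W.conductorNorm ℤ) := ⟨(W.conductorNorm_pos_holds).ne'⟩
  have hp : p.Prime := Fact.out
  have hp2 : p ≠ 2 := by omega
  have hCM : ¬ W.HasCM := fun hcm ↦ not_hasSurjectiveModNGaloisRep_of_hasCM W hcm hp hp2 hsurjp
  have hirr : Irr W p := hasIrreducibleModPGaloisRep_of_hasSurjectiveModNGaloisRep W p hsurjp
  have hj : 0 ≤ padicValRat p W.j := not_lt.mp hG.1
  obtain ⟨K₀, _, _, Dt₀, -, -, -, -, -, -, -, -, -, -, -, -, hc₀, -, -, -⟩ := hM hPub W p hp5 hadd hirr hr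
  exact missingLowerBoundAt_rankOne_additive_potGood_of_kolyvaginClasses_lt hPub hKatoT W p hCM hp2 hadd hj hr
    (serre_hasSurjectiveModNGaloisRep_pow_holds W p hp5 hsurjp) ⟨Dt₀, hc₀⟩
    (fun K _ _ Dt β ι hK hodd hlt hHN hLt hβ hc ↦
      hKA W p K Dt β ι hp5 hadd (Or.inr hG) hsurjp hsp htwo htam hr hK hodd hlt hHN hLt hβ hc)

/-- **Crux `GordTwoRankOne` (item 19358) AT THE PAIR on every ♯ row of cell (G-ord, `e = 2`) at `p ≥ 5`
from the abelian-type child crux of route `AdditiveKolyvaginRoad` + Manin-good frames + PUB** (♯ = `ρ̄`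
onto ∧ ♠(1) ∧ ♠(2) ∧ `p ∤ ∏c(E)`); STEP L′ and `RankZeroAdditive` both drop out.
[cite: WZhang2014, Thm. 1.1] [cite: McCallumLMS1991, §5 Cor. 5.6] [cite: Kato2004Asterisque, Thm. 14.5 (3)] -/
theorem cellGordTwo_missingLowerBoundAt_rankOne_sharp_of_kolyvaginPrimitiveAdditiveAbelianType
    (hPub : PublishedInputsAdditiveKoly) (hM : ManinGoodOddFrameAdditive)
    (hKA : KolyvaginPrimitiveAdditiveAbelianType)
    (hKatoT : Kato2004.rankZero_padicValNat_sha_add_padicValNat_tamagawa_le_of_additive_potGood_of_imageContainsSL2) :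
    ∀ (W : WeierstrassCurve ℚ) [W.IsElliptic] [W.IsGloballyMinimal] (p : ℕ) [Fact p.Prime],
      W.analyticRank = 1 → N10.CellGordTwo W p → 5 ≤ p → W.HasSurjectiveModNGaloisRep p →
      (∀ (ℓ : ℕ) [Fact ℓ.Prime], W.HasMultiplicativeReductionAtPrime ℓ →
        ¬ p ∣ padicValInt ℓ W.minimalDiscriminantInt) →
      (∃ (ℓ₁ ℓ₂ : ℕ) (_ : Fact ℓ₁.Prime) (_ : Fact ℓ₂.Prime), ℓ₁ ≠ ℓ₂ ∧
        W.HasMultiplicativeReductionAtPrime ℓ₁ ∧ W.HasMultiplicativeReductionAtPrime ℓ₂) →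
      ¬ p ∣ W.tamagawaProduct → Typed.MissingLowerBoundAt W p := by
  intro W _ _ p _ hr hc2 hp5 hsurjp hsp htwo htam
  obtain ⟨hp2, hadd, hG, -⟩ := hc2
  exact missingLowerBoundAt_rankOne_subGord_sharp_of_kolyvaginPrimitiveAdditiveAbelianType hPub hM hKA hKatoT
    W p hp5 hadd (subGord_of_typeGOrd_of_addv W p hp2 hG hadd) hr hsurjp hsp htwo htam

/-- **The same at `p ≥ 11` WITHOUT the sibling's Manin-good-frame item**: on cell (G-ord, `e = 2`) = Kodaira
`I₀*` at `p > 7` the Manin-unit datum is lane B's Part 2 theorem from Edixhoven 1991 Thm. 3 (`hEdxK`), the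
Néron mapping property (`hNS`) and modularity (`hmodP`; `hnf` inside `hPub`) — so on the ♯ rows at
`p ≥ 11` the ONLY open binder is the child crux `KolyvaginPrimitiveAdditiveAbelianType` (item 20418).
[cite: EdixhovenManin1991, Thm. 3] [cite: WZhang2014, Thm. 1.1] [cite: Kato2004Asterisque, Thm. 14.5 (3) (p. 236)] -/
theorem cellGordTwo_missingLowerBoundAt_rankOne_sharp_eleven_of_kolyvaginPrimitiveAdditiveAbelianType
    (hPub : PublishedInputsAdditiveKoly) (hKA : KolyvaginPrimitiveAdditiveAbelianType)
    (hKatoT : Kato2004.rankZero_padicValNat_sha_add_padicValNat_tamagawa_le_of_additive_potGood_of_imageContainsSL2)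
    (hmodP : nonempty_modularParametrizationData)
    (hEdxK : edixhoven_not_dvd_maninConstant_of_kodairaSymbol_ne)
    (hNS : integral_neronScaling_of_isGloballyMinimal) :
    ∀ (W : WeierstrassCurve ℚ) [W.IsElliptic] [W.IsGloballyMinimal] (p : ℕ) [Fact p.Prime],
      W.analyticRank = 1 → N10.CellGordTwo W p → 11 ≤ p → W.HasSurjectiveModNGaloisRep p →
      (∀ (ℓ : ℕ) [Fact ℓ.Prime], W.HasMultiplicativeReductionAtPrime ℓ →
        ¬ p ∣ padicValInt ℓ W.minimalDiscriminantInt) →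
      (∃ (ℓ₁ ℓ₂ : ℕ) (_ : Fact ℓ₁.Prime) (_ : Fact ℓ₂.Prime), ℓ₁ ≠ ℓ₂ ∧
        W.HasMultiplicativeReductionAtPrime ℓ₁ ∧ W.HasMultiplicativeReductionAtPrime ℓ₂) →
      ¬ p ∣ W.tamagawaProduct → Typed.MissingLowerBoundAt W p := by
  intro W _ _ p _ hr hc2 hp11 hsurjp hsp htwo htam
  haveI : NeZero (W.conductorNorm ℤ) := ⟨(W.conductorNorm_pos_holds).ne'⟩
  have hp : p.Prime := Fact.out
  obtain ⟨hp2, hadd, hG⟩ : p ≠ 2 ∧ Addv W p ∧ TypeGOrd W p := ⟨hc2.1, hc2.2.1, hc2.2.2.1⟩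
  have hp5 : 5 ≤ p := by omega
  have hCM : ¬ W.HasCM := fun hcm ↦ not_hasSurjectiveModNGaloisRep_of_hasCM W hcm hp hp2 hsurjp
  have hirr : Irr W p := hasIrreducibleModPGaloisRep_of_hasSurjectiveModNGaloisRep W p hsurjp
  have hj : 0 ≤ padicValRat p W.j := not_lt.mp (N10.not_potMult_of_typeGOrd W p hp2 hadd hG)
  have hD : ∃ Dt : ModularParametrizationData W (W.conductorNorm ℤ), ¬ (p : ℤ) ∣ Dt.c :=
    exists_modularParametrizationData_not_dvd_of_cellGordTwo hPub.2.2.2.2.2.1 hmodP hEdxK hNS W p hc2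
      (by omega) hirr
  exact missingLowerBoundAt_rankOne_additive_potGood_of_kolyvaginClasses_lt hPub hKatoT W p hCM hp2 hadd hj hr
    (serre_hasSurjectiveModNGaloisRep_pow_holds W p hp5 hsurjp) hD (fun K _ _ Dt β ι hK hodd hlt hHN hLt hβ hc ↦
      hKA W p K Dt β ι hp5 hadd (Or.inr (subGord_of_typeGOrd_of_addv W p hp2 hG hadd)) hsurjp hsp htwo htam
        hr hK hodd hlt hHN hLt hβ hc)

/-- **K1's crux `GordHigherLower` (item 19360) AT THE PAIR on its RANK-ONE ♯ rows** (cell (G-ord,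
`e ∈ {3,4,6}`), `p ≥ 5` forced): the same LOWER half from the abelian-type child crux + Manin-good frames +
PUB — the defect `e` never enters the horizontal road. [cite: WZhang2014, Thm. 1.1 and Thm. 10.2]
[cite: McCallumLMS1991, §5 Cor. 5.6 (p. 310)] [cite: Kato2004Asterisque, Thm. 14.5 (3) (p. 236)] -/
theorem cellGordHigher_missingLowerBoundAt_rankOne_sharp_of_kolyvaginPrimitiveAdditiveAbelianType
    (hPub : PublishedInputsAdditiveKoly) (hM : ManinGoodOddFrameAdditive)
    (hKA : KolyvaginPrimitiveAdditiveAbelianType)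
    (hKatoT : Kato2004.rankZero_padicValNat_sha_add_padicValNat_tamagawa_le_of_additive_potGood_of_imageContainsSL2) :
    ∀ (W : WeierstrassCurve ℚ) [W.IsElliptic] [W.IsGloballyMinimal] (p : ℕ) [Fact p.Prime],
      W.analyticRank = 1 → N10.CellGordHigher W p → 5 ≤ p → W.HasSurjectiveModNGaloisRep p →
      (∀ (ℓ : ℕ) [Fact ℓ.Prime], W.HasMultiplicativeReductionAtPrime ℓ →
        ¬ p ∣ padicValInt ℓ W.minimalDiscriminantInt) →
      (∃ (ℓ₁ ℓ₂ : ℕ) (_ : Fact ℓ₁.Prime) (_ : Fact ℓ₂.Prime), ℓ₁ ≠ ℓ₂ ∧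
        W.HasMultiplicativeReductionAtPrime ℓ₁ ∧ W.HasMultiplicativeReductionAtPrime ℓ₂) →
      ¬ p ∣ W.tamagawaProduct → Typed.MissingLowerBoundAt W p := by
  intro W _ _ p _ hr hcH hp5 hsurjp hsp htwo htam
  obtain ⟨hp2, hadd, hG, -⟩ := hcH
  exact missingLowerBoundAt_rankOne_subGord_sharp_of_kolyvaginPrimitiveAdditiveAbelianType hPub hM hKA hKatoT
    W p hp5 hadd (subGord_of_typeGOrd_of_addv W p hp2 hG hadd) hr hsurjp hsp htwo htam
/-! ### §24 The crux BY NAME: ♯ rows from the sibling crux, CM by Li–Liu–Tian, off-♯ rows displayed -/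

/-- **Crux `GordTwoRankOne` (item 19358) BY NAME — HORIZONTAL form.** PUBLISHED binders: the sibling
route's `PublishedInputsAdditiveKoly` (`hPub`), Kato 14.5 (3) (`hKatoT`), Li–Liu–Tian 2024 (`hLLT`, CM rows,
lane A's `gordTwoRankOne_cm_of_liLiuTian`); OPEN binders BY NAME: the sibling's Manin-good frames (`hM`,
item 20136) and its crux child `KolyvaginPrimitiveAdditiveAbelianType` (`hKA`, item 20418); DISPLAYED: the
crux on the non-CM OFF-♯ rows (`hRest`: `p = 3`, `ρ̄` not onto, ♠ fails, or `p ∣ ∏c(E)`). An honest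
split, not a closure; nothing booked; 19358 stays OPEN. [cite: WZhang2014, Thm. 1.1 and Thm. 10.2]
[cite: McCallumLMS1991, §5 Cor. 5.6 (p. 310)] [cite: Kato2004Asterisque, Thm. 14.5 (3) (p. 236)]
[cite: LiLiuTian2024, Thm. 1.1 (i)] [cite: Miller2011LMS, Def. 1.1] -/
theorem gordTwoRankOne_of_kolyvaginPrimitiveAdditiveAbelianType_of_rest
    (hPub : PublishedInputsAdditiveKoly) (hM : ManinGoodOddFrameAdditive)
    (hKA : KolyvaginPrimitiveAdditiveAbelianType)
    (hKatoT : Kato2004.rankZero_padicValNat_sha_add_padicValNat_tamagawa_le_of_additive_potGood_of_imageContainsSL2)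
    (hLLT : LiLiuTian2024.thm11_bsdp_of_cm_rank_one)
    (hRest : ∀ (W : WeierstrassCurve ℚ) [W.IsElliptic] [W.IsGloballyMinimal] (p : ℕ) [Fact p.Prime],
      W.analyticRank = 1 → N10.CellGordTwo W p → ¬ W.HasCM →
      ¬ (5 ≤ p ∧ W.HasSurjectiveModNGaloisRep p ∧
        (∀ (ℓ : ℕ) [Fact ℓ.Prime], W.HasMultiplicativeReductionAtPrime ℓ →
          ¬ p ∣ padicValInt ℓ W.minimalDiscriminantInt) ∧
        (∃ (ℓ₁ ℓ₂ : ℕ) (_ : Fact ℓ₁.Prime) (_ : Fact ℓ₂.Prime), ℓ₁ ≠ ℓ₂ ∧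
          W.HasMultiplicativeReductionAtPrime ℓ₁ ∧ W.HasMultiplicativeReductionAtPrime ℓ₂) ∧
        ¬ p ∣ W.tamagawaProduct) → Typed.MissingLowerBoundAt W p) :
    Summit.BirchSwinnertonDyer.BirchSwinnertonDyer.Theses.AdditiveBranchIMC.GordTwoRankOne := by
  intro W _ _ p _ hr hc2
  by_cases hcm : W.HasCM
  · exact gordTwoRankOne_cm_of_liLiuTian hLLT W p hr hc2 hcm
  by_cases hsh : 5 ≤ p ∧ W.HasSurjectiveModNGaloisRep p ∧
      (∀ (ℓ : ℕ) [Fact ℓ.Prime], W.HasMultiplicativeReductionAtPrime ℓ →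
        ¬ p ∣ padicValInt ℓ W.minimalDiscriminantInt) ∧
      (∃ (ℓ₁ ℓ₂ : ℕ) (_ : Fact ℓ₁.Prime) (_ : Fact ℓ₂.Prime), ℓ₁ ≠ ℓ₂ ∧
        W.HasMultiplicativeReductionAtPrime ℓ₁ ∧ W.HasMultiplicativeReductionAtPrime ℓ₂) ∧
      ¬ p ∣ W.tamagawaProduct
  · obtain ⟨hp5, hsurjp, hsp, htwo, htam⟩ := hsh
    exact cellGordTwo_missingLowerBoundAt_rankOne_sharp_of_kolyvaginPrimitiveAdditiveAbelianType hPub hM hKA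
      hKatoT W p hr hc2 hp5 hsurjp hsp htwo htam
  · exact hRest W p hr hc2 hcm hsh

/-- **Crux `GordTwoRankOne` BY NAME — HORIZONTAL form with ONE open binder on the ♯ rows at `p ≥ 11`.** As
above with the Manin-good frames replaced by Edixhoven 1991 Thm. 3 + Néron + modularity (PUB, lane B Part 2):
on the ♯ rows at `p ≥ 11` the only non-published input is `KolyvaginPrimitiveAdditiveAbelianType` (item
20418); DISPLAYED: the non-CM rows that are off-♯ OR at `p ∈ {3, 5, 7}` (`hRest`). Nothing booked.
[cite: EdixhovenManin1991, Thm. 3] [cite: WZhang2014, Thm. 1.1 and Thm. 10.2] [cite: LiLiuTian2024, Thm. 1.1 (i)]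
[cite: Kato2004Asterisque, Thm. 14.5 (3) (p. 236)] [cite: Miller2011LMS, Def. 1.1] -/
theorem gordTwoRankOne_of_kolyvaginPrimitiveAdditiveAbelianType_eleven_of_rest
    (hPub : PublishedInputsAdditiveKoly) (hKA : KolyvaginPrimitiveAdditiveAbelianType)
    (hKatoT : Kato2004.rankZero_padicValNat_sha_add_padicValNat_tamagawa_le_of_additive_potGood_of_imageContainsSL2)
    (hmodP : nonempty_modularParametrizationData)
    (hEdxK : edixhoven_not_dvd_maninConstant_of_kodairaSymbol_ne)
    (hNS : integral_neronScaling_of_isGloballyMinimal)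
    (hLLT : LiLiuTian2024.thm11_bsdp_of_cm_rank_one)
    (hRest : ∀ (W : WeierstrassCurve ℚ) [W.IsElliptic] [W.IsGloballyMinimal] (p : ℕ) [Fact p.Prime],
      W.analyticRank = 1 → N10.CellGordTwo W p → ¬ W.HasCM →
      ¬ (11 ≤ p ∧ W.HasSurjectiveModNGaloisRep p ∧
        (∀ (ℓ : ℕ) [Fact ℓ.Prime], W.HasMultiplicativeReductionAtPrime ℓ →
          ¬ p ∣ padicValInt ℓ W.minimalDiscriminantInt) ∧
        (∃ (ℓ₁ ℓ₂ : ℕ) (_ : Fact ℓ₁.Prime) (_ : Fact ℓ₂.Prime), ℓ₁ ≠ ℓ₂ ∧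
          W.HasMultiplicativeReductionAtPrime ℓ₁ ∧ W.HasMultiplicativeReductionAtPrime ℓ₂) ∧
        ¬ p ∣ W.tamagawaProduct) → Typed.MissingLowerBoundAt W p) :
    Summit.BirchSwinnertonDyer.BirchSwinnertonDyer.Theses.AdditiveBranchIMC.GordTwoRankOne := by
  intro W _ _ p _ hr hc2
  by_cases hcm : W.HasCM
  · exact gordTwoRankOne_cm_of_liLiuTian hLLT W p hr hc2 hcm
  by_cases hsh : 11 ≤ p ∧ W.HasSurjectiveModNGaloisRep p ∧
      (∀ (ℓ : ℕ) [Fact ℓ.Prime], W.HasMultiplicativeReductionAtPrime ℓ →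
        ¬ p ∣ padicValInt ℓ W.minimalDiscriminantInt) ∧
      (∃ (ℓ₁ ℓ₂ : ℕ) (_ : Fact ℓ₁.Prime) (_ : Fact ℓ₂.Prime), ℓ₁ ≠ ℓ₂ ∧
        W.HasMultiplicativeReductionAtPrime ℓ₁ ∧ W.HasMultiplicativeReductionAtPrime ℓ₂) ∧
      ¬ p ∣ W.tamagawaProduct
  · obtain ⟨hp11, hsurjp, hsp, htwo, htam⟩ := hsh
    exact cellGordTwo_missingLowerBoundAt_rankOne_sharp_eleven_of_kolyvaginPrimitiveAdditiveAbelianType hPub hKA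
      hKatoT hmodP hEdxK hNS W p hr hc2 hp11 hsurjp hsp htwo htam
  · exact hRest W p hr hc2 hcm hsh
/-! ### §25 Item 20498 (STEP L′, every datum) on the ♯ rows: sibling crux + crux 19357 at the twist -/

/-- **STEP L′ (item 20498's body) at EVERY datum of a ♯ row of cell (G-ord, `e = 2`) at `p ≥ 5`, from the
abelian-type child crux + PUB AND the rank-zero LOWER half at the datum's twist** (`htwL`, crux 19357's
conclusion at `(Wd, p)` — Part 9's no-free-lunch input). Data exactly as in item 20498 (ANY Heegner field,
datum, Heegner point, minimal twist model): §23 gives `Typed.MissingLowerBoundAt W p` (datum-free), Part 9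
returns STEP L′ at the datum (`p ∤ #𝓞_K^×` automatic, Part 12; torsion-Heegner-point corner: index `0`).
On the ♯ rows: `20418 ∧ 19357(twists) ∧ PUB ⟹ 20498`. [cite: WZhang2014, Thm. 1.1 and Thm. 10.2]
[cite: McCallumLMS1991, §5 Cor. 5.6 (p. 310)] [cite: JetchevSkinnerWan2017, §7.4.1 (pp. 29–31)]
[cite: GrossZagier1986, V.§2 and Conj. (V.2.2)] [cite: Miller2011LMS, Def. 1.1] -/
theorem adjustedHeegnerIndexBound_sharp_of_kolyvaginPrimitiveAdditiveAbelianType_of_twistLower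
    (hPub : PublishedInputsAdditiveKoly) (hM : ManinGoodOddFrameAdditive)
    (hKA : KolyvaginPrimitiveAdditiveAbelianType)
    (hKatoT : Kato2004.rankZero_padicValNat_sha_add_padicValNat_tamagawa_le_of_additive_potGood_of_imageContainsSL2)
    (W : WeierstrassCurve ℚ) [W.IsElliptic] [W.IsGloballyMinimal] (p : ℕ) [Fact p.Prime]
    (N : ℕ) [NeZero N] (K : Type) [Field K] [NumberField K]
    (Dt : ModularParametrizationData W N) (H : HeegnerDatum N (NumberField.discr K)) (ι : K →+* ℂ)
    (P : (W.baseChange K).toAffine.Point)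
    (Wd : WeierstrassCurve ℚ) [Wd.IsElliptic] [Wd.IsGloballyMinimal] (Cd : VariableChange ℚ)
    (hr : W.analyticRank = 1) (hc2 : N10.CellGordTwo W p) (hp5 : 5 ≤ p)
    (hsurjp : W.HasSurjectiveModNGaloisRep p)
    (hsp : ∀ (ℓ : ℕ) [Fact ℓ.Prime], W.HasMultiplicativeReductionAtPrime ℓ →
      ¬ p ∣ padicValInt ℓ W.minimalDiscriminantInt)
    (htwo : ∃ (ℓ₁ ℓ₂ : ℕ) (_ : Fact ℓ₁.Prime) (_ : Fact ℓ₂.Prime), ℓ₁ ≠ ℓ₂ ∧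
      W.HasMultiplicativeReductionAtPrime ℓ₁ ∧ W.HasMultiplicativeReductionAtPrime ℓ₂)
    (htam : ¬ p ∣ W.tamagawaProduct)
    (hN : W.conductorNorm ℤ = N) (hK : IsImaginaryQuadratic K) (hHN : SatisfiesHeegnerHypothesis N K)
    (hP : WeierstrassCurve.Affine.Point.map ι.toRatAlgHom P = heegnerPointComplex Dt H)
    (hWd : Cd • W.quadraticTwist (NumberField.discr K : ℚ) = Wd)
    (htwL : Typed.MissingLowerBoundAt Wd p) :
    (2 * padicValNat p (AddSubgroup.zmultiples P).index : ℤ) ≤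
      padicValNat p (W.baseChange K).shaOrder + padicValNat p W.tamagawaProduct +
        padicValNat p Wd.tamagawaProduct + 2 * padicValRat p (Dt.c : ℚ) := by
  have hp : p.Prime := Fact.out
  have hlow : Typed.MissingLowerBoundAt W p :=
    cellGordTwo_missingLowerBoundAt_rankOne_sharp_of_kolyvaginPrimitiveAdditiveAbelianType hPub hM hKA hKatoT W p
      hr hc2 hp5 hsurjp hsp htwo htam
  obtain ⟨hp2, hadd, -, -⟩ := hc2
  obtain ⟨hGZ, hKo, -, hGZK, hmod, -, -, -, -, -⟩ := hPub
  have hpN : p ∣ N := by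
    rw [← hN]; exact (W.dvd_conductorNorm_iff_not_hasGoodReductionAtPrime p).mpr hadd.1
  have hμ : ¬ p ∣ Units.torsionOrder K := not_dvd_unitsTorsionOrder_of_heegner hK hHN hp hp2 hpN
  by_cases hLt : (W.quadraticTwist (NumberField.discr K : ℚ)).entireLFunction 1 = 0
  · -- degenerate corner (Part 12): torsion Heegner point, index `0`
    have htor : IsOfFinAddOrder P :=
      isOfFinAddOrder_heegnerPoint_of_twist_value_eq_zero W N K Dt H ι P (hGZ N W K) hmod hK hHN hP hr hLt
    haveI : Infinite (W.baseChange K).toAffine.Point :=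
      infinite_point_baseChange_of_analyticRank_eq_one hGZK W K hK.1 hr
    rw [index_zmultiples_eq_zero_of_isOfFinAddOrder htor]
    have e3 : (0 : ℤ) ≤ padicValRat p (Dt.c : ℚ) := by rw [padicValRat.of_int]; positivity
    have e4 : (0 : ℤ) ≤ (padicValNat p (W.baseChange K).shaOrder : ℤ) + padicValNat p W.tamagawaProduct +
        padicValNat p Wd.tamagawaProduct := by positivity
    simp only [padicValNat_zero_right, Nat.cast_zero, mul_zero]
    linarith
  · -- generic case: Part 9's no-free-lunch mechanism at this datum
    subst hN
    have hu : padicValRat p (Cd.u : ℚ) = 0 :=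
      padicValRat_u_eq_zero_of_twist_minimal' W p K hK hHN hadd.1 Cd hWd
    exact adjustedIndexBound_of_missingLowerBoundAt_of_twistLower W p (W.conductorNorm ℤ) K Dt H ι P (hGZ _ W K)
      (hKo _ W K) hGZK hmod hK hHN hP hp2 hμ hr hLt Wd Cd hWd hu hlow htwL

end Summit.BirchSwinnertonDyer.BirchSwinnertonDyer.Theorems.AdditiveBranchIMCGordTwoRankOne.HeegnerKolyvagin

end
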